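import Summits.Ventures.YMGap.Thresholds.OneLinkCasimirTwo
import Summits.Ventures.YMGap.Thresholds.OneLinkPoissonCovariance
import HarnessLib

/-!
# Venture YMGap — the one-link modulus beyond first order, part 4: the FEEDBACK RULES — the carré du champ of the
# weight `Re tr(· B)` against the quadratic trace polynomials, in closed form on `SU(N)`

HONEST FRAMING: venture file of the cell `pub-ymgap` (QuantumFields programme), strong-coupling LATTICE bookkeeping for `SU(N)`
lattice Yang–Mills; nothing about the continuum or the mass gap in the Clay sense.  Pure matrix calculus («F2» of the cell note
`HOME/p2/ONE-LINK-HIERARCHY.md` §2.3); no measure, no number of record.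

WHAT.  The remainder of the second-order Poisson solution is the CUBIC `c₃ = Γ(Re tr(· B), ψ₂)` (`OneLinkCasimirTwo`,
`OneLinkLevelTwoCovariance`).  To bound its gradient one needs `Γ(Re tr(· B), f)` for the three quadratic shapes `f` that make up
`ψ₂`.  On `SU(N)` (where `g gᴴ = 1` collapses one word to a LINEAR statistic):
* `Gam_potB_reTrQuad`:  `Γ(Re tr(·B), Re tr(QM₁QM₂))(g) = −½[Re tr(BgM₁gM₂g) + Re tr(BgM₂gM₁g)] + ½[Re tr(gM₂BᴴM₁) + Re tr(gM₁BᴴM₂)]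
   − (2/N) Im tr(Bg) Im tr(gM₁gM₂)`;
* `Gam_potB_reTrProd`:  `Γ(Re tr(·B), Re(tr(QM₁)tr(QM₂)))(g) = −½ Re[tr(gM₂) tr(BgM₁g) + tr(gM₁) tr(BgM₂g)]
   + ½ Re[tr(gM₂) tr(M₁Bᴴ) + tr(gM₁) tr(M₂Bᴴ)] − (2/N) Im tr(Bg) Im(tr(gM₁)tr(gM₂))`;
* `Gam_potB_reTrProdConj`:  `Γ(Re tr(·B), Re(tr(QM₁) conj tr(QM₂)))(g) = −½ Re[conj tr(gM₂) tr(BgM₁g) + conj tr(gM₁) tr(BgM₂g)]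
   + ½ Re[conj tr(gM₂) tr(M₁Bᴴ) + conj tr(gM₁) tr(M₂Bᴴ)]`  (the trace–trace terms cancel).
Content: `Γ(Re tr(·B), ·)` maps degree `k` to {degree `k+1` words} + {degree `k−1` words} + `(1/N)·Im tr(Bg)·`{degree `k`}; the
algebra closes without Weingarten calculus.  Each identity was checked numerically on `SU(3…6)` (cell folder `HOME/p2/hier/alg_check.py`,
(C5), residual 1e-12) before being proved here from the tree's bilinear Parseval identity `sum_re_trace_frame_mul_mul` and
`Gam_pot_pot_su`.

References: cell notes `HOME/p2/ONE-LINK-HIERARCHY.md` §2.3; T. Bröcker, T. tom Dieck, GTM 98, II.5 (orthogonality relations).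
-/

noncomputable section

open scoped Matrix ComplexConjugate BigOperators
open Matrix Complex Finset
open Literature.MathematicalPhysics.QuantumFieldTheory
open Literature.MathematicalPhysics.QuantumFieldTheory.SUNBakryEmery

namespace Summit.Ventures.YMGap.OneLinkEigen

variable {N : ℕ}

/-- `Re tr(B Xᴴ) = Re tr(X Bᴴ)`. [folklore] -/
theorem re_trace_mul_conjTranspose_comm (B X : Matrix (Fin N) (Fin N) ℂ) :
    (B * Xᴴ).trace.re = (X * Bᴴ).trace.re := by
  rw [show B * Xᴴ = (X * Bᴴ)ᴴ by rw [conjTranspose_mul, conjTranspose_conjTranspose], trace_conjTranspose, star_def, conj_re]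

/-- `tr(M Bᴴ) = conj tr(B Mᴴ)`. [folklore] -/
theorem trace_mul_conjTranspose_comm (B M : Matrix (Fin N) (Fin N) ℂ) :
    (M * Bᴴ).trace = (starRingEnd ℂ) (B * Mᴴ).trace := by
  rw [show M * Bᴴ = (B * Mᴴ)ᴴ by rw [conjTranspose_mul, conjTranspose_conjTranspose], trace_conjTranspose, star_def]

/-- `D_Y Re tr(· B) (Q) = Re tr(Y (B Q))`. [folklore] -/
theorem matD_pot_one (Y B Q : Matrix (Fin N) (Fin N) ℂ) : matD Y (pot 1 B) Q = (Y * (B * Q)).trace.re := by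
  rw [show pot (N := N) 1 B = fun Q => 1 * (Q * B).trace.re from rfl, matD_const_mul_reTrMul]
  show 1 * (Q * Y * B).trace.re = _
  rw [one_mul, Matrix.mul_assoc, trace_mul_comm, Matrix.mul_assoc]

section Calc

open scoped Matrix.Norms.Frobenius ContDiff Topology

/-- **Feedback rule for the quadratic word** (on `SU(N)`):
`Γ(Re tr(·B), Re tr(QM₁QM₂))(g) = −½[Re tr(BgM₁gM₂g) + Re tr(BgM₂gM₁g)] + ½[Re tr(gM₂BᴴM₁) + Re tr(gM₁BᴴM₂)] − (2/N) Im tr(Bg) Im tr(gM₁gM₂)`.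
[folklore] -/
theorem Gam_potB_reTrQuad (hN : N ≠ 0) (B M₁ M₂ : Matrix (Fin N) (Fin N) ℂ) (g : SUN N) :
    Gam (pot 1 B) (fun Q : Matrix (Fin N) (Fin N) ℂ => (Q * M₁ * Q * M₂).trace.re) g =
      -(1 / 2) * ((B * g * M₁ * g * M₂ * g).trace.re + (B * g * M₂ * g * M₁ * g).trace.re)
        + (1 / 2) * (((g : Matrix (Fin N) (Fin N) ℂ) * M₂ * Bᴴ * M₁).trace.re
          + ((g : Matrix (Fin N) (Fin N) ℂ) * M₁ * Bᴴ * M₂).trace.re)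
        - (2 / N) * (B * (g : Matrix (Fin N) (Fin N) ℂ)).trace.im
          * ((g : Matrix (Fin N) (Fin N) ℂ) * M₁ * g * M₂).trace.im := by
  set Q : Matrix (Fin N) (Fin N) ℂ := (g : Matrix (Fin N) (Fin N) ℂ) with hQ
  have h2 : ∀ α : FrameIdx N, matD (frame α) (fun Q : Matrix (Fin N) (Fin N) ℂ => (Q * M₁ * Q * M₂).trace.re) Q =
      (frame α * (M₁ * Q * M₂ * Q)).trace.re + (frame α * (M₂ * Q * M₁ * Q)).trace.re := by
    intro α
    rw [matD_reTrQuad]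
    show (Q * frame α * M₁ * Q * M₂).trace.re + (Q * M₁ * Q * frame α * M₂).trace.re = _
    congr 1
    · rw [show Q * frame α * M₁ * Q * M₂ = Q * (frame α * (M₁ * Q * M₂)) by simp only [Matrix.mul_assoc], trace_mul_comm]
      simp only [Matrix.mul_assoc]
    · rw [show Q * M₁ * Q * frame α * M₂ = (Q * M₁ * Q) * (frame α * M₂) by simp only [Matrix.mul_assoc], trace_mul_comm]
      simp only [Matrix.mul_assoc]
  show ∑ α, matD (frame α) (pot 1 B) Q * matD (frame α) (fun Q : Matrix (Fin N) (Fin N) ℂ => (Q * M₁ * Q * M₂).trace.re) Q = _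
  simp_rw [matD_pot_one, h2, mul_add, sum_add_distrib, sum_re_trace_frame_mul_mul hN]
  -- the `ᴴ`-terms collapse on `SU(N)`
  have hc1 : (B * Q * (M₁ * Q * M₂ * Q)ᴴ).trace.re = (Q * M₂ * Bᴴ * M₁).trace.re := by
    rw [show M₁ * Q * M₂ * Q = (M₁ * Q * M₂) * Q by simp only [Matrix.mul_assoc], hQ, mul_su_mul_conjTranspose,
      re_trace_mul_conjTranspose_comm]
    simp only [Matrix.mul_assoc]
    rw [trace_mul_comm M₁]
    simp only [Matrix.mul_assoc]
  have hc2 : (B * Q * (M₂ * Q * M₁ * Q)ᴴ).trace.re = (Q * M₁ * Bᴴ * M₂).trace.re := by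
    rw [show M₂ * Q * M₁ * Q = (M₂ * Q * M₁) * Q by simp only [Matrix.mul_assoc], hQ, mul_su_mul_conjTranspose,
      re_trace_mul_conjTranspose_comm]
    simp only [Matrix.mul_assoc]
    rw [trace_mul_comm M₂]
    simp only [Matrix.mul_assoc]
  have ht1 : (M₁ * Q * M₂ * Q).trace.im = (Q * M₁ * Q * M₂).trace.im := by
    rw [show M₁ * Q * M₂ * Q = (M₁ * Q * M₂) * Q by simp only [Matrix.mul_assoc], ← trace_mul_comm Q]
    simp only [Matrix.mul_assoc]
  have ht2 : (M₂ * Q * M₁ * Q).trace.im = (Q * M₁ * Q * M₂).trace.im := by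
    rw [show M₂ * Q * M₁ * Q = (M₂ * (Q * M₁)) * Q by simp only [Matrix.mul_assoc], ← trace_mul_comm Q,
      show Q * (M₂ * (Q * M₁)) = (Q * M₂) * (Q * M₁) by simp only [Matrix.mul_assoc], trace_mul_comm]
    simp only [Matrix.mul_assoc]
  rw [hc1, hc2, ht1, ht2]
  simp only [Matrix.mul_assoc]
  ring

/-- `Γ(Re tr(·B), Re tr(·M))` on `SU(N)` (tree `Gam_pot_pot_su`, unit weights). [folklore] -/
theorem Gam_potB_pot_one (hN : N ≠ 0) (B M : Matrix (Fin N) (Fin N) ℂ) (g : SUN N) :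
    Gam (pot 1 B) (pot 1 M) g =
      -(1 / 2) * (B * g * M * g).trace.re + (1 / 2) * (B * Mᴴ).trace.re
        - (1 / N) * (B * (g : Matrix (Fin N) (Fin N) ℂ)).trace.im * (M * (g : Matrix (Fin N) (Fin N) ℂ)).trace.im := by
  rw [Gam_pot_pot_su hN]; ring

/-- `Γ(Re tr(·B), Im tr(·M)) = Γ(Re tr(·B), Re tr(·(−iM)))` on `SU(N)`:
`−½ Im tr(BgMg) − ½ Im tr(BMᴴ) + (1/N) Im tr(Bg) Re tr(Mg)`. [folklore] -/
theorem Gam_potB_pot_negI (hN : N ≠ 0) (B M : Matrix (Fin N) (Fin N) ℂ) (g : SUN N) :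
    Gam (pot 1 B) (pot 1 ((-I) • M)) g =
      -(1 / 2) * (B * g * M * g).trace.im - (1 / 2) * (B * Mᴴ).trace.im
        + (1 / N) * (B * (g : Matrix (Fin N) (Fin N) ℂ)).trace.im * (M * (g : Matrix (Fin N) (Fin N) ℂ)).trace.re := by
  rw [Gam_pot_pot_su hN]
  have h1 : (B * g * ((-I) • M) * g).trace.re = (B * g * M * g).trace.im := by
    rw [Matrix.mul_smul, Matrix.smul_mul, trace_smul, smul_eq_mul, mul_re, neg_re, neg_im, I_re, I_im]; ring
  have h2 : (B * ((-I) • M)ᴴ).trace.re = -(B * Mᴴ).trace.im := by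
    rw [conjTranspose_smul, Matrix.mul_smul, trace_smul, smul_eq_mul, star_def, map_neg, conj_I, neg_neg, mul_re, I_re,
      I_im]; ring
  have h3 : ((-I) • M * (g : Matrix (Fin N) (Fin N) ℂ)).trace.im = -(M * (g : Matrix (Fin N) (Fin N) ℂ)).trace.re := by
    rw [Matrix.smul_mul, trace_smul, smul_eq_mul, mul_im, neg_re, neg_im, I_re, I_im]; ring
  rw [h1, h2, h3]; ring

/-- **Feedback rule for the product** (on `SU(N)`):
`Γ(Re tr(·B), Re(tr(QM₁)tr(QM₂)))(g) = −½Re[tr(gM₂)tr(BgM₁g) + tr(gM₁)tr(BgM₂g)] + ½Re[tr(gM₂)tr(M₁Bᴴ) + tr(gM₁)tr(M₂Bᴴ)]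
 − (2/N) Im tr(Bg) Im(tr(gM₁)tr(gM₂))`. [folklore] -/
theorem Gam_potB_reTrProd (hN : N ≠ 0) (B M₁ M₂ : Matrix (Fin N) (Fin N) ℂ) (g : SUN N) :
    Gam (pot 1 B) (fun Q : Matrix (Fin N) (Fin N) ℂ => ((Q * M₁).trace * (Q * M₂).trace).re) g =
      -(1 / 2) * ((((g : Matrix (Fin N) (Fin N) ℂ) * M₂).trace * (B * g * M₁ * g).trace).re
          + (((g : Matrix (Fin N) (Fin N) ℂ) * M₁).trace * (B * g * M₂ * g).trace).re)
        + (1 / 2) * ((((g : Matrix (Fin N) (Fin N) ℂ) * M₂).trace * (M₁ * Bᴴ).trace).re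
          + (((g : Matrix (Fin N) (Fin N) ℂ) * M₁).trace * (M₂ * Bᴴ).trace).re)
        - (2 / N) * (B * (g : Matrix (Fin N) (Fin N) ℂ)).trace.im
          * (((g : Matrix (Fin N) (Fin N) ℂ) * M₁).trace * ((g : Matrix (Fin N) (Fin N) ℂ) * M₂).trace).im := by
  rw [reTrProd_eq, Gam_comm, show (pot 1 M₁ * pot 1 M₂ - pot 1 ((-I) • M₁) * pot 1 ((-I) • M₂) : Matrix (Fin N) (Fin N) ℂ → ℝ)
      = pot 1 M₁ * pot 1 M₂ + (-1 : ℝ) • (pot 1 ((-I) • M₁) * pot 1 ((-I) • M₂)) by ext; simp; ring]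
  have hA : ContDiff ℝ ∞ (pot 1 M₁ * pot 1 M₂) := (contDiff_pot 1 M₁).mul (contDiff_pot 1 M₂)
  have hB : ContDiff ℝ ∞ ((-1 : ℝ) • (pot 1 ((-I) • M₁) * pot 1 ((-I) • M₂))) := by
    have h := ((contDiff_pot 1 ((-I) • M₁)).mul (contDiff_pot 1 ((-I) • M₂))).const_smul (-1 : ℝ); exact h
  rw [Gam_comm, Gam_add_right _ hA hB]
  have hs : Gam (pot 1 B) ((-1 : ℝ) • (pot 1 ((-I) • M₁) * pot 1 ((-I) • M₂))) g =
      -Gam (pot 1 B) (pot 1 ((-I) • M₁) * pot 1 ((-I) • M₂)) g := by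
    simp only [Gam]
    rw [← sum_neg_distrib]
    refine sum_congr rfl fun α _ => ?_
    have : matD (frame α) ((-1 : ℝ) • (pot 1 ((-I) • M₁) * pot 1 ((-I) • M₂))) =
        fun Q => (-1 : ℝ) * matD (frame α) (pot 1 ((-I) • M₁) * pot 1 ((-I) • M₂)) Q :=
      matD_const_mul ((contDiff_pot 1 _).mul (contDiff_pot 1 _)) (-1) _
    rw [this]; ring
  rw [hs, Gam_comm (pot 1 B), Gam_mul_left (contDiff_pot 1 M₁) (contDiff_pot 1 M₂), Gam_comm (pot 1 B),
    Gam_mul_left (contDiff_pot 1 _) (contDiff_pot 1 _), Gam_comm (pot 1 M₂), Gam_comm (pot 1 M₁),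
    Gam_comm (pot 1 ((-I) • M₂)), Gam_comm (pot 1 ((-I) • M₁)),
    Gam_potB_pot_one hN, Gam_potB_pot_one hN, Gam_potB_pot_negI hN, Gam_potB_pot_negI hN]
  simp only [pot, one_mul, re_trace_mul_negI_smul]
  have e1 : ∀ M : Matrix (Fin N) (Fin N) ℂ, (M * (g : Matrix (Fin N) (Fin N) ℂ)).trace =
      ((g : Matrix (Fin N) (Fin N) ℂ) * M).trace := fun M => trace_mul_comm _ _
  rw [e1 M₁, e1 M₂, trace_mul_conjTranspose_comm B M₁, trace_mul_conjTranspose_comm B M₂]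
  simp only [mul_re, mul_im, conj_re, conj_im]
  ring

/-- **Feedback rule for the mixed product** (on `SU(N)`):
`Γ(Re tr(·B), Re(tr(QM₁) conj tr(QM₂)))(g) = −½Re[conj tr(gM₂) tr(BgM₁g) + conj tr(gM₁) tr(BgM₂g)]
 + ½Re[conj tr(gM₂) tr(M₁Bᴴ) + conj tr(gM₁) tr(M₂Bᴴ)]` — the trace–trace terms cancel. [folklore] -/
theorem Gam_potB_reTrProdConj (hN : N ≠ 0) (B M₁ M₂ : Matrix (Fin N) (Fin N) ℂ) (g : SUN N) :
    Gam (pot 1 B) (fun Q : Matrix (Fin N) (Fin N) ℂ => ((Q * M₁).trace * (starRingEnd ℂ) (Q * M₂).trace).re) g =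
      -(1 / 2) * (((starRingEnd ℂ) ((g : Matrix (Fin N) (Fin N) ℂ) * M₂).trace * (B * g * M₁ * g).trace).re
          + ((starRingEnd ℂ) ((g : Matrix (Fin N) (Fin N) ℂ) * M₁).trace * (B * g * M₂ * g).trace).re)
        + (1 / 2) * (((starRingEnd ℂ) ((g : Matrix (Fin N) (Fin N) ℂ) * M₂).trace * (M₁ * Bᴴ).trace).re
          + ((starRingEnd ℂ) ((g : Matrix (Fin N) (Fin N) ℂ) * M₁).trace * (M₂ * Bᴴ).trace).re) := by
  rw [reTrProdConj_eq]
  have hA : ContDiff ℝ ∞ (pot 1 M₁ * pot 1 M₂) := (contDiff_pot 1 M₁).mul (contDiff_pot 1 M₂)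
  have hB : ContDiff ℝ ∞ (pot 1 ((-I) • M₁) * pot 1 ((-I) • M₂)) := (contDiff_pot 1 ((-I) • M₁)).mul (contDiff_pot 1 ((-I) • M₂))
  rw [Gam_add_right _ hA hB, Gam_comm (pot 1 B), Gam_mul_left (contDiff_pot 1 M₁) (contDiff_pot 1 M₂), Gam_comm (pot 1 B),
    Gam_mul_left (contDiff_pot 1 _) (contDiff_pot 1 _), Gam_comm (pot 1 M₂), Gam_comm (pot 1 M₁),
    Gam_comm (pot 1 ((-I) • M₂)), Gam_comm (pot 1 ((-I) • M₁)),
    Gam_potB_pot_one hN, Gam_potB_pot_one hN, Gam_potB_pot_negI hN, Gam_potB_pot_negI hN]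
  simp only [pot, one_mul, re_trace_mul_negI_smul]
  have e1 : ∀ M : Matrix (Fin N) (Fin N) ℂ, (M * (g : Matrix (Fin N) (Fin N) ℂ)).trace =
      ((g : Matrix (Fin N) (Fin N) ℂ) * M).trace := fun M => trace_mul_comm _ _
  rw [e1 M₁, e1 M₂, trace_mul_conjTranspose_comm B M₁, trace_mul_conjTranspose_comm B M₂]
  simp only [mul_re, conj_re, conj_im]
  ring

end Calc

end Summit.Ventures.YMGap.OneLinkEigen
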